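import Summits.AtomisticToContinuum.Crystallization.Theorems.ChartedPlanarOrderChannelJacobian

/-!
# ChartedPlanarOrder — the channel-Jacobian TRUNCATION bound (lens-3 g25, Part B §6)

The Hessian-form certificate of `…ChannelJacobian` (`HessCertAdj` / `HessCertFar`) is a bound on the INFINITE lattice sum
`⟪hess a b x D, D⟫ = -Σ'_{ij ∈ ℤ²} ⟪J(l_ij - x) D, D⟫` (`inner_hess_eq_tsum`).  A numerical replay (census TAG 182) evaluates a FINITE part
`ij ∈ F`; this module bounds the remainder by an explicit closed form:

* `tsum_norm_pairJac_tail` — for any finite `F ⊂ ℤ²` whose complement sits at distance `≥ R` from `x` (`R ≤ ‖l_ij - x‖` for `ij ∉ F`), a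
  height floor `t ≤ |⟪ν, x⟫|` and a cell radius `R_c`:  `Σ_{ij ∉ F} ‖J(l_ij - x)‖ ≤ (4π/√G)·[15(1+ε)⁷/(6T⁶) + 9(1+ε)⁴/(3T³)]` with
  `T = (1+ε)(¾R² + ¼t²) − (1+1/ε)(R_c/2)² > 0` (the smear bound of `…LatticeSmear` applied to the half-scaled lattice `(a/2, b/2)` after the
  splitting `r² ≥ ¾R² + ¼(t² + ‖P‖²)` on far sites);
* `hessTail R := (4π/(73/100))·(320/T⁶ + 48/T³)`, `T = (3/2)R² − 36/125` (the record instance `ε = 1`, `t = 13/25`, `R_c = 23/25`, `√G ≥ 73/100`);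
* ★ `abs_inner_hess_add_sum_le` — on the configurations of record (the data of `regularWindowsG`), for every window point `x`
  (`13/25 ≤ |⟪ν₀, x⟫|`), every finite `F` and every `R ≥ 1` with `R ≤ ‖l_ij - x‖` off `F`:
  `|⟪hess a b x D, D⟫ + Σ_{ij ∈ F} ⟪J(l_ij - x) D, D⟫| ≤ hessTail R · ‖D‖²`.

So a TAG 182 row may certify the block bounds of `HessCertAdj` / `HessCertFar` from the finite sum over `F` plus `hessTail R` (e.g.
`hessTail 6 ≤ 6/1000`, `hessTail 8 ≤ 1/1000`, proved below by `norm_num`).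
-/

noncomputable section

namespace Summit.AtomisticToContinuum.Crystallization.Theorems.ChartedPlanarOrderChannelJacobian

open Metric Set Real
open scoped RealInnerProductSpace
open Summit.AtomisticToContinuum.Crystallization.Theorems.ChartedPlanarOrderRigidityDoor (E3)
open Summit.AtomisticToContinuum.Crystallization.Theorems.ChartedPlanarOrderProfileSlavingLJ (pairForce layerForce incr offsetOf tube
  IsStacked gapStress)
open Summit.AtomisticToContinuum.Crystallization.Theorems.ChartedPlanarOrderPairModulus (modulus modulus_nonneg exists_planar gram_pos)
open Summit.AtomisticToContinuum.Crystallization.Theorems.ChartedPlanarOrderStackedLayerGeometry (inner_period_combo)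
open Summit.AtomisticToContinuum.Crystallization.Theorems.ChartedPlanarOrderLayerFrame (norm_sq_add_smul_normal)
open Summit.AtomisticToContinuum.Crystallization.Theorems.ChartedPlanarOrderLatticeSmear (norm_sq_lin tsum_modulus_le_smear)
open Summit.AtomisticToContinuum.Crystallization.Theorems.ChartedPlanarOrderHeightFloor (cleanStackedWindows)
open Summit.AtomisticToContinuum.Crystallization.Theorems.ChartedPlanarOrderDoorLayered (Layered)
open Summit.AtomisticToContinuum.Crystallization.Theorems.OverbindingBudgetPeriodicCleanOrStrained (UniformlyClean)

/-! ## §6.1 The site identity and the half-scaled lattice -/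

/-- the site decomposition: `‖v + l_ij‖² = ‖P_ij‖² + ⟪ν, v⟫²` with `P_ij = (i + c₁) a + (j + c₂) b` the planar part. -/
theorem site_norm_sq {ν a b v : E3} (hν : ‖ν‖ = 1) (hνa : ⟪ν, a⟫ = 0) (hνb : ⟪ν, b⟫ = 0) {c₁ c₂ : ℝ}
    (hc : v - ⟪ν, v⟫ • ν = c₁ • a + c₂ • b) (ij : ℤ × ℤ) :
    ‖v + ((ij.1 : ℝ) • a + (ij.2 : ℝ) • b)‖ ^ 2 = ‖((ij.1 : ℝ) + c₁) • a + ((ij.2 : ℝ) + c₂) • b‖ ^ 2 + ⟪ν, v⟫ ^ 2 := by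
  have hv : v = c₁ • a + c₂ • b + ⟪ν, v⟫ • ν := by rw [← hc, sub_add_cancel]
  have hsite : v + ((ij.1 : ℝ) • a + (ij.2 : ℝ) • b) = (((ij.1 : ℝ) + c₁) • a + ((ij.2 : ℝ) + c₂) • b) + ⟪ν, v⟫ • ν := by
    nth_rewrite 1 [hv]
    module
  rw [hsite, norm_sq_add_smul_normal hν (inner_period_combo hνa hνb _ _)]

/-- the half-scaled periods are still independent. [folklore] -/
theorem linearIndependent_half {a b : E3} (hab : LinearIndependent ℝ ![a, b]) :
    LinearIndependent ℝ ![(1 / 2 : ℝ) • a, (1 / 2 : ℝ) • b] := by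
  rw [LinearIndependent.pair_iff] at hab ⊢
  intro s t hst
  have h := hab (s / 2) (t / 2) (by rw [← hst]; module)
  exact ⟨by linarith [h.1], by linarith [h.2]⟩

/-- the Gram root of the half-scaled periods: `√G' = √G/4`. -/
theorem sqrt_gram_half (a b : E3) :
    Real.sqrt (‖(1 / 2 : ℝ) • a‖ ^ 2 * ‖(1 / 2 : ℝ) • b‖ ^ 2 - ⟪(1 / 2 : ℝ) • a, (1 / 2 : ℝ) • b⟫ ^ 2) =
      Real.sqrt (‖a‖ ^ 2 * ‖b‖ ^ 2 - ⟪a, b⟫ ^ 2) / 4 := by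
  have h : ‖(1 / 2 : ℝ) • a‖ ^ 2 * ‖(1 / 2 : ℝ) • b‖ ^ 2 - ⟪(1 / 2 : ℝ) • a, (1 / 2 : ℝ) • b⟫ ^ 2 =
      (‖a‖ ^ 2 * ‖b‖ ^ 2 - ⟪a, b⟫ ^ 2) / 4 ^ 2 := by
    rw [norm_smul, norm_smul, real_inner_smul_left, real_inner_smul_right, Real.norm_eq_abs, abs_of_pos (by norm_num : (0:ℝ) < 1 / 2)]
    ring
  rw [h, Real.sqrt_div' _ (by norm_num), Real.sqrt_sq (by norm_num)]

/-! ## §6.2 The norm tail -/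

/-- ★ THE NORM TAIL.  `Σ_{ij ∉ F} ‖J(v + l_ij)‖ ≤ (4π/√G)·[15(1+ε)⁷/(6T⁶) + 9(1+ε)⁴/(3T³)]`, `T = (1+ε)(¾R² + ¼t²) − (1+1/ε)(R_c/2)²`,
whenever `t ≤ |⟪ν, v⟫|` and the sites off `F` are at distance `≥ R` (`0 ≤ R ≤ ‖v + l_ij‖`, `ij ∉ F`). -/
theorem tsum_norm_pairJac_tail {ν a b v : E3} (hν : ‖ν‖ = 1) (hνa : ⟪ν, a⟫ = 0) (hνb : ⟪ν, b⟫ = 0)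
    (hab : LinearIndependent ℝ ![a, b]) {t R Rc ε : ℝ} (ht : 0 < t) (htv : t ≤ |⟪ν, v⟫|) (hR : 0 ≤ R) (hε : 0 < ε)
    (hRc : ∀ ζ₁ ζ₂ : ℝ, |ζ₁| ≤ 1 / 2 → |ζ₂| ≤ 1 / 2 → ‖ζ₁ • a + ζ₂ • b‖ ≤ Rc)
    (hT : 0 < (1 + ε) * (3 / 4 * R ^ 2 + 1 / 4 * t ^ 2) - (1 + ε⁻¹) * (Rc / 2) ^ 2)
    (F : Finset (ℤ × ℤ)) (hF : ∀ ij ∉ F, R ≤ ‖v + ((ij.1 : ℝ) • a + (ij.2 : ℝ) • b)‖) :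
    Summable (fun ij : ℤ × ℤ => if ij ∈ F then (0:ℝ) else ‖pairJac (v + ((ij.1 : ℝ) • a + (ij.2 : ℝ) • b))‖) ∧
      ∑' ij : ℤ × ℤ, (if ij ∈ F then (0:ℝ) else ‖pairJac (v + ((ij.1 : ℝ) • a + (ij.2 : ℝ) • b))‖) ≤
        4 * π / Real.sqrt (‖a‖ ^ 2 * ‖b‖ ^ 2 - ⟪a, b⟫ ^ 2) *
          (15 * (1 + ε) ^ 7 / (6 * ((1 + ε) * (3 / 4 * R ^ 2 + 1 / 4 * t ^ 2) - (1 + ε⁻¹) * (Rc / 2) ^ 2) ^ 6) +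
            9 * (1 + ε) ^ 4 / (3 * ((1 + ε) * (3 / 4 * R ^ 2 + 1 / 4 * t ^ 2) - (1 + ε⁻¹) * (Rc / 2) ^ 2) ^ 3)) := by
  obtain ⟨c₁, c₂, hc⟩ := exists_planar hab hν hνa hνb v
  -- the shifted height and the half-scaled lattice
  set t' : ℝ := Real.sqrt (3 / 4 * R ^ 2 + 1 / 4 * t ^ 2) with ht'
  have ht'sq : t' ^ 2 = 3 / 4 * R ^ 2 + 1 / 4 * t ^ 2 := Real.sq_sqrt (by positivity)
  have hab' := linearIndependent_half hab
  have hRc' : ∀ ζ₁ ζ₂ : ℝ, |ζ₁| ≤ 1 / 2 → |ζ₂| ≤ 1 / 2 → ‖ζ₁ • ((1 / 2 : ℝ) • a) + ζ₂ • ((1 / 2 : ℝ) • b)‖ ≤ Rc / 2 := by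
    intro ζ₁ ζ₂ h₁ h₂
    have e : ζ₁ • ((1 / 2 : ℝ) • a) + ζ₂ • ((1 / 2 : ℝ) • b) = (1 / 2 : ℝ) • (ζ₁ • a + ζ₂ • b) := by module
    rw [e, norm_smul, Real.norm_eq_abs, abs_of_pos (by norm_num : (0:ℝ) < 1 / 2)]
    linarith [hRc ζ₁ ζ₂ h₁ h₂]
  have hT' : 0 < (1 + ε) * t' ^ 2 - (1 + ε⁻¹) * (0 + Rc / 2) ^ 2 := by rw [ht'sq, zero_add]; exact hT
  set m : ℤ × ℤ → ℝ := fun ij => ‖((ij.1 : ℝ) + c₁) • ((1 / 2 : ℝ) • a) + ((ij.2 : ℝ) + c₂) • ((1 / 2 : ℝ) • b)‖ with hm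
  obtain ⟨hμ, hbound⟩ := tsum_modulus_le_smear hab' hε hRc' hT' c₁ c₂ (m := m) (fun ij => by rw [add_zero])
  -- the per-site comparison
  have hP : ∀ ij : ℤ × ℤ, m ij = ‖((ij.1 : ℝ) + c₁) • a + ((ij.2 : ℝ) + c₂) • b‖ / 2 := by
    intro ij
    have e : ((ij.1 : ℝ) + c₁) • ((1 / 2 : ℝ) • a) + ((ij.2 : ℝ) + c₂) • ((1 / 2 : ℝ) • b) =
        (1 / 2 : ℝ) • (((ij.1 : ℝ) + c₁) • a + ((ij.2 : ℝ) + c₂) • b) := by module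
    simp only [hm]
    rw [e, norm_smul, Real.norm_eq_abs, abs_of_pos (by norm_num : (0:ℝ) < 1 / 2)]
    ring
  have hr : ∀ ij : ℤ × ℤ, 0 < Real.sqrt (t' ^ 2 + m ij ^ 2) := fun ij => Real.sqrt_pos.2 (by rw [ht'sq]; positivity)
  have htv2 : t ^ 2 ≤ ⟪ν, v⟫ ^ 2 := by nlinarith [sq_abs ⟪ν, v⟫, abs_nonneg ⟪ν, v⟫]
  have hsite : ∀ ij ∉ F, Real.sqrt (t' ^ 2 + m ij ^ 2) ≤ ‖v + ((ij.1 : ℝ) • a + (ij.2 : ℝ) • b)‖ := by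
    intro ij hij
    have h1 := site_norm_sq hν hνa hνb hc ij
    have h2 : R ^ 2 ≤ ‖v + ((ij.1 : ℝ) • a + (ij.2 : ℝ) • b)‖ ^ 2 := pow_le_pow_left₀ hR (hF ij hij) 2
    calc Real.sqrt (t' ^ 2 + m ij ^ 2) ≤ Real.sqrt (‖v + ((ij.1 : ℝ) • a + (ij.2 : ℝ) • b)‖ ^ 2) :=
          Real.sqrt_le_sqrt (by rw [ht'sq, hP, div_pow]; nlinarith)
      _ = _ := Real.sqrt_sq (norm_nonneg _)
  -- comparison with the smeared majorant
  have hle : ∀ ij : ℤ × ℤ, (if ij ∈ F then (0:ℝ) else ‖pairJac (v + ((ij.1 : ℝ) • a + (ij.2 : ℝ) • b))‖) ≤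
      modulus (Real.sqrt (t' ^ 2 + m ij ^ 2)) := by
    intro ij
    split_ifs with hij
    · exact modulus_nonneg _
    · exact norm_pairJac_le (hr ij) (hsite ij hij)
  have h0 : ∀ ij : ℤ × ℤ, 0 ≤ (if ij ∈ F then (0:ℝ) else ‖pairJac (v + ((ij.1 : ℝ) • a + (ij.2 : ℝ) • b))‖) := by
    intro ij; split_ifs <;> positivity
  have hsum : Summable (fun ij : ℤ × ℤ => if ij ∈ F then (0:ℝ) else ‖pairJac (v + ((ij.1 : ℝ) • a + (ij.2 : ℝ) • b))‖) :=
    Summable.of_nonneg_of_le h0 hle hμ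
  refine ⟨hsum, le_trans (hsum.tsum_le_tsum hle hμ) (le_trans hbound (le_of_eq ?_))⟩
  rw [sqrt_gram_half, ht'sq, zero_add]
  ring

/-! ## §6.3 The record tail and the truncation inequality -/

/-- the record tail constant: `hessTail R = (4π/(73/100))·(320/T⁶ + 48/T³)`, `T = (3/2)R² − 36/125`
(`ε = 1`, `t = 13/25`, `R_c = 23/25`, `√G ≥ 73/100`). -/
def hessTail (R : ℝ) : ℝ := 4 * π / (73 / 100) * (320 / ((3 / 2) * R ^ 2 - 36 / 125) ^ 6 + 48 / ((3 / 2) * R ^ 2 - 36 / 125) ^ 3)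

/-- `hessTail 6 ≤ 6/1000`. -/
theorem hessTail_six : hessTail 6 ≤ 6 / 1000 := by
  unfold hessTail; nlinarith [Real.pi_lt_d2]

/-- `hessTail 8 ≤ 1/1000`. -/
theorem hessTail_eight : hessTail 8 ≤ 1 / 1000 := by
  unfold hessTail; nlinarith [Real.pi_lt_d2]

/-- `hessTail 12 ≤ 1/10000`. -/
theorem hessTail_twelve : hessTail 12 ≤ 1 / 10000 := by
  unfold hessTail; nlinarith [Real.pi_lt_d2]

/-- ★ the windows of record with the Gram floor: normal `ν₀`, heights `≥ 31/50`, cell radius `≤ 23/25`, and `√G ≥ 73/100`. -/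
theorem regularWindowsG {a b : E3} {w' : ℤ → E3} (hst : IsStacked a b w') (hab : LinearIndependent ℝ ![a, b]) (ha : ‖a‖ ≤ 17 / 16)
    (hb : ‖b‖ ≤ 17 / 16) (hUC : UniformlyClean (Layered a b w')) :
    ∃ ν₀ : E3, ‖ν₀‖ = 1 ∧ ⟪ν₀, a⟫ = 0 ∧ ⟪ν₀, b⟫ = 0 ∧ (∀ i : ℤ, 31 / 50 ≤ ⟪ν₀, incr w' i⟫) ∧
      (∀ ζ₁ ζ₂ : ℝ, |ζ₁| ≤ 1 / 2 → |ζ₂| ≤ 1 / 2 → ‖ζ₁ • a + ζ₂ • b‖ ≤ 23 / 25) ∧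
      73 / 100 ≤ Real.sqrt (‖a‖ ^ 2 * ‖b‖ ^ 2 - ⟪a, b⟫ ^ 2) := by
  obtain ⟨ν, a', hν, hνa, hνb, ha'lo, ha'hi, ⟨halo, hahi⟩, ⟨hblo, hbhi⟩, hp, -, -, hG, hfl, -⟩ := cleanStackedWindows hst hab ha hb hUC
  obtain ⟨ν₀, hν₀, hν₀a, hν₀b, hfl₀, hcell⟩ := regularWindows hst hab ha hb hUC
  refine ⟨ν₀, hν₀, hν₀a, hν₀b, hfl₀, hcell, ?_⟩
  have hq : (2303 / 2500 : ℝ) ≤ a' * (49 / 50) := by linarith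
  have hq4 : (2303 / 2500 : ℝ) ^ 4 ≤ (a' * (49 / 50)) ^ 4 := pow_le_pow_left₀ (by norm_num) hq 4
  have h49 : (73 / 100 : ℝ) ^ 2 ≤ 3 / 4 * (a' * (49 / 50)) ^ 4 := by nlinarith [hq4]
  exact Real.le_sqrt_of_sq_le (h49.trans hG)

/-- ★★ THE TRUNCATION INEQUALITY.  On the windows of record (`ν₀ ⟂ a, b`, cell radius `≤ 23/25`, `√G ≥ 73/100`), for every `x` with
`13/25 ≤ |⟪ν₀, x⟫|`, every finite `F ⊂ ℤ²` and every `R ≥ 1` with `R ≤ ‖l_ij − x‖` for `ij ∉ F`: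
`|⟪hess a b x D, D⟫ + Σ_{ij ∈ F} ⟪J(l_ij − x) D, D⟫| ≤ hessTail R · ‖D‖²`. -/
theorem abs_inner_hess_add_sum_le {ν₀ a b x : E3} (hν : ‖ν₀‖ = 1) (hνa : ⟪ν₀, a⟫ = 0) (hνb : ⟪ν₀, b⟫ = 0)
    (hab : LinearIndependent ℝ ![a, b]) (hRc : ∀ ζ₁ ζ₂ : ℝ, |ζ₁| ≤ 1 / 2 → |ζ₂| ≤ 1 / 2 → ‖ζ₁ • a + ζ₂ • b‖ ≤ 23 / 25)
    (hG : 73 / 100 ≤ Real.sqrt (‖a‖ ^ 2 * ‖b‖ ^ 2 - ⟪a, b⟫ ^ 2)) (hx : 13 / 25 ≤ |⟪ν₀, x⟫|)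
    (F : Finset (ℤ × ℤ)) {R : ℝ} (hR : 1 ≤ R) (hF : ∀ ij ∉ F, R ≤ ‖-x + ((ij.1 : ℝ) • a + (ij.2 : ℝ) • b)‖) (D : E3) :
    |⟪hess a b x D, D⟫ + ∑ ij ∈ F, ⟪pairJac (-x + ((ij.1 : ℝ) • a + (ij.2 : ℝ) • b)) D, D⟫| ≤ hessTail R * ‖D‖ ^ 2 := by
  -- the series form of the Hessian form
  have hS := summable_pairJac (v := -x) hν hνa hνb hab (t := 1 / 2) (d := 1 / 50) (Rc := 23 / 25) (ε := 4) (by norm_num) (by norm_num)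
    (by norm_num) hRc (by norm_num) (by rw [inner_neg_right, abs_neg]; linarith)
  set f : ℤ × ℤ → ℝ := fun ij => ⟪pairJac (-x + ((ij.1 : ℝ) • a + (ij.2 : ℝ) • b)) D, D⟫ with hf
  have hfS : Summable f := by
    have h1 : Summable (fun ij : ℤ × ℤ => pairJac (-x + ((ij.1 : ℝ) • a + (ij.2 : ℝ) • b)) D) := by
      simpa only [ContinuousLinearMap.apply_apply] using (ContinuousLinearMap.apply ℝ E3 D).summable hS
    have h2 := (innerSL ℝ D).summable h1
    refine h2.congr fun ij => ?_
    simp only [innerSL_apply_apply, hf, real_inner_comm]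
  have hform : ⟪hess a b x D, D⟫ = -∑' ij : ℤ × ℤ, f ij := by
    rw [hess, show (-layerJac a b (-x)) D = -(layerJac a b (-x) D) from rfl, inner_neg_left, inner_layerJac hS]
  -- the norm tail at the record parameters
  have hT : 0 < (1 + (1:ℝ)) * (3 / 4 * R ^ 2 + 1 / 4 * (13 / 25) ^ 2) - (1 + (1:ℝ)⁻¹) * ((23 / 25) / 2) ^ 2 := by nlinarith
  obtain ⟨hμS, hμ⟩ := tsum_norm_pairJac_tail (v := -x) hν hνa hνb hab (t := 13 / 25) (R := R) (Rc := 23 / 25) (ε := 1)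
    (by norm_num) (by rw [inner_neg_right, abs_neg]; exact hx) (by linarith) (by norm_num) hRc hT F hF
  set μ : ℤ × ℤ → ℝ := fun ij => if ij ∈ F then (0:ℝ) else ‖pairJac (-x + ((ij.1 : ℝ) • a + (ij.2 : ℝ) • b))‖ with hμdef
  have hTail : ∑' ij : ℤ × ℤ, μ ij ≤ hessTail R := by
    refine le_trans hμ ?_
    have hTpos : 0 < (3 / 2 : ℝ) * R ^ 2 - 36 / 125 := by nlinarith
    have eT : (1 + (1:ℝ)) * (3 / 4 * R ^ 2 + 1 / 4 * (13 / 25) ^ 2) - (1 + (1:ℝ)⁻¹) * ((23 / 25) / 2) ^ 2 = (3 / 2) * R ^ 2 - 36 / 125 := by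
      norm_num; ring
    rw [eT, hessTail]
    have hB : 0 ≤ (320 / ((3 / 2 : ℝ) * R ^ 2 - 36 / 125) ^ 6 + 48 / ((3 / 2) * R ^ 2 - 36 / 125) ^ 3) := by positivity
    have e2 : 15 * (1 + (1:ℝ)) ^ 7 / (6 * ((3 / 2) * R ^ 2 - 36 / 125) ^ 6) + 9 * (1 + (1:ℝ)) ^ 4 / (3 * ((3 / 2) * R ^ 2 - 36 / 125) ^ 3) =
        320 / ((3 / 2) * R ^ 2 - 36 / 125) ^ 6 + 48 / ((3 / 2) * R ^ 2 - 36 / 125) ^ 3 := by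
      field_simp; ring
    rw [e2]
    exact mul_le_mul_of_nonneg_right (div_le_div_of_nonneg_left (by positivity) (by norm_num) hG) hB
  -- splitting off the finite part
  set g : ℤ × ℤ → ℝ := fun ij => if ij ∈ F then (0:ℝ) else f ij with hg
  have hfin : ∑' ij : ℤ × ℤ, (if ij ∈ F then f ij else 0) = ∑ ij ∈ F, f ij := by
    rw [tsum_eq_sum (s := F) (fun ij hij => if_neg hij)]
    exact Finset.sum_congr rfl fun ij hij => if_pos hij
  have hfinS : Summable (fun ij : ℤ × ℤ => if ij ∈ F then f ij else 0) := summable_of_ne_finset_zero (s := F) (fun ij hij => if_neg hij)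
  have hgle : ∀ ij : ℤ × ℤ, ‖g ij‖ ≤ μ ij * ‖D‖ ^ 2 := by
    intro ij
    simp only [hg, hμdef]
    split_ifs with hij
    · simp
    · rw [Real.norm_eq_abs, hf]
      calc |⟪pairJac (-x + ((ij.1 : ℝ) • a + (ij.2 : ℝ) • b)) D, D⟫|
          ≤ ‖pairJac (-x + ((ij.1 : ℝ) • a + (ij.2 : ℝ) • b)) D‖ * ‖D‖ := abs_real_inner_le_norm _ _
        _ ≤ ‖pairJac (-x + ((ij.1 : ℝ) • a + (ij.2 : ℝ) • b))‖ * ‖D‖ * ‖D‖ :=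
          mul_le_mul_of_nonneg_right (ContinuousLinearMap.le_opNorm _ _) (norm_nonneg _)
        _ = _ := by ring
  have hgnS : Summable (fun ij : ℤ × ℤ => ‖g ij‖) :=
    Summable.of_nonneg_of_le (fun _ => norm_nonneg _) hgle (hμS.mul_right _)
  have hgS : Summable g := hgnS.of_norm
  have hsplit : ∑' ij : ℤ × ℤ, f ij = ∑ ij ∈ F, f ij + ∑' ij : ℤ × ℤ, g ij := by
    rw [← hfin, ← hfinS.tsum_add hgS]
    refine tsum_congr fun ij => ?_
    simp only [hg]; split_ifs <;> simp
  rw [hform, hsplit, show -(∑ ij ∈ F, f ij + ∑' ij : ℤ × ℤ, g ij) + ∑ ij ∈ F, f ij = -∑' ij : ℤ × ℤ, g ij by ring, abs_neg]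
  calc |∑' ij : ℤ × ℤ, g ij| = ‖∑' ij : ℤ × ℤ, g ij‖ := (Real.norm_eq_abs _).symm
    _ ≤ ∑' ij : ℤ × ℤ, ‖g ij‖ := norm_tsum_le_tsum_norm hgnS
    _ ≤ ∑' ij : ℤ × ℤ, μ ij * ‖D‖ ^ 2 := hgnS.tsum_le_tsum hgle (hμS.mul_right _)
    _ = (∑' ij : ℤ × ℤ, μ ij) * ‖D‖ ^ 2 := tsum_mul_right
    _ ≤ hessTail R * ‖D‖ ^ 2 := mul_le_mul_of_nonneg_right hTail (by positivity)

end Summit.AtomisticToContinuum.Crystallization.Theorems.ChartedPlanarOrderChannelJacobian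

end
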